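import Summits.QuantumFields.YangMills.Theorems.UnitScaleTiltProp8IterPlaqSmall
import Literature.MathematicalPhysics.QuantumFieldTheory.Balaban1983to89.T3Thm1CarrierNative
import Literature.MathematicalPhysics.QuantumFieldTheory.Balaban1983to89.B6SectAOperatorsV1
import HarnessLib

/-!
# Route `UnitScaleTilt`, crux K1 «MinimiserStabilityRegPr» (stmt-QuantumFields-19200), leaf V2′ `stub_halvingStep` — pillar P0 `Localise150`, TEXT + THE
# `L ≥ 7` HALF PROVED: **THE LOCALISATION (144)–(151) OF [Balaban1985Variational] SECT. F AT THE d = 3 CARRIER, SUBSET FORM**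

Cell `ym3-torus` ∕ fleet seat `ym-ust-19200-p2` g5 (v8 PEN; OWNER RULING g21-№5 §2 (a) «P0 := the SUBSET form now (criticality over `regFibrePr e V ∩ 𝒞_cube(U)`;
true and trivial)», §5 «P0's text is ∀ L > 1 and its L ≥ 7 half is discharged by `plaqSmall_iter_T3(_lt)`; the L ∈ {3,5} half is the honest residual»;
junction J0 SETTLED YES, g22-№1 §C, lemma `FlatCubeConstraintsFibre.iter_eq_of_constraints` (p1 g15) for the equality form).

THE TEXT `Localise150At L C a` (a Prop-valued predicate; nothing asserted): for every member `F` (`F.L = L`), heights `n < K`, `0 < ε₀ ≤ a`, every datum `V` and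
every configuration `U` with `U ∈ 𝔘_k(ε₀)` ([Balaban1985Variational] (2), both clauses: `RegPr`), `U ∈ 𝔅_k(V)` (the (0.4)-descent fibre) and `U` critical in
reading R2 (`IsCritR2`: a minimiser of the Wilson action over print's regular fibre (6)(e) for SOME `e > 0`):
(i) **MULTI-LEVEL SMALLNESS (146)**: for every `i ≤ K − n` the `i`-fold (0.4)-average `Ū^{(i)}` is `C·ε₀·L^{2i}·L^{−2(K−n)}`-small (plaquette variables) —
GAUGE-FREE and k-UNIFORM (print obtains it inside the cube from the axial gauge (145); the axial-gauge bond closeness (151) itself is the contour form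
`IterPlaqSmall.dist1_contour_iter_le_T3`, derivable from the same hypothesis, so it is not repeated in the text);
(ii) **LOCAL CRITICALITY (150), SUBSET FORM**: for EVERY nested domain family `D` on the fine torus of run `K` with `D.k = K − n` ([Balaban1984PropagatorsII]
(2.1)–(2.4); the cube sequence (144) = `FlatCubeSequence.cubeSeqT3`/`cubeSeqMT3`) there is `e > 0` with `U ∈ (6)(e)` minimising the Wilson action over
`(6)(e) ∩ 𝒞_D(U)`, `𝒞_D(U) := {U″ | every multi-level (0.4)-datum of U″ on the constraint index set BondIdx D equals that of U}` (print p.301: «U′_k is a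
minimum … in the space (150), because this space is defined by more restrictive conditions»; by J0 / `iter_eq_of_constraints` the set `𝒞_D(U)` lies in
the fibre of `V`, so the subset form IS print's (150) modulo regularity).
PROVED: `localise150At_of_isCritR2` (conjunct (ii) alone holds for EVERY `L`, trivially: `IsMinOn.on_subset`), **`localise150At_of_ge7`**: `7 ≤ L ⇒
Localise150At L 505 (2·10⁸·L³)⁻¹` (conjunct (i) by `IterPlaqSmall.plaqSmall_iter_T3`).  STUB SHAPE OF RECORD (v8; NOT declared here):
`theorem stub_localise150 : ∀ (L : ℕ), 1 < L → ∃ (C a : ℝ), 0 < a ∧ Prop8Localise.Localise150At L C a` — its `7 ≤ L` half is the theorem below; the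
`L ∈ {3, 5}` half of (i) is the honest residual (needs the loop-flux cancellation / gradient control, card).  NOT a claim about the mass gap.

References: T. Bałaban, CMP **102** (1985) 277–309 [Balaban1985Variational] ((2), (6) p.278, (144)–(151) pp.300–301); CMP **96** (1984) 223–250
[Balaban1984PropagatorsII] ((2.1)–(2.4) p.224).
-/

noncomputable section

open scoped BigOperators Matrix.Norms.L2Operator

namespace Summit.QuantumFields.YangMills.Theorems.Prop8Localise

open Literature.MathematicalPhysics.QuantumFieldTheory.Balaban1983to89
open T3ContinuumYM3Torus T3UnitLawDensityEML T3ConstrainedMinimiser T3RegularMinimiser T3PrintedRegularMinimiser T3Thm1CarrierNative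
open BlockAveraging ExpMeanLog
open B6SectADomainsV1 (Domains)
open B6SectAOperatorsV1 (BondIdx)
open Summit.QuantumFields.YangMills.Theorems.IterPlaqSmall (plaqSmall_iter_T3)

/-- **THE MULTI-LEVEL (0.4)-CONSTRAINT SET OF A CONFIGURATION ON A NESTED DOMAIN FAMILY** — the space (150) of [Balaban1985Variational] without its
regularity clauses: the configurations `U″` whose `j`-fold (0.4)-averages agree with those of `U` at every constraint index `(j, c)`, `c ∈ Λ_j`, `j = 0, …, k`
(`BondIdx D`; level `0` = the frozen exterior `Λ₀ = T ∖ Ω₁`). [cite: Balaban1985Variational, (149)-(150) p.301; Balaban1984PropagatorsII, (2.3)-(2.6) p.224] -/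
def constraintSet {P : Params} (D : Domains P) (U : GaugeField P 0 (Matrix.specialUnitaryGroup (Fin 2) ℂ)) :
    Set (GaugeField P 0 (Matrix.specialUnitaryGroup (Fin 2) ℂ)) :=
  {U'' | ∀ i : BondIdx D,
    Averaging.iter (fun j => blockAvg (P := P) (j := j) (expMeanLogSU (n := Fin 2))) (i.1.1 : ℕ) U'' i.1.2 =
      Averaging.iter (fun j => blockAvg (P := P) (j := j) (expMeanLogSU (n := Fin 2))) (i.1.1 : ℕ) U i.1.2}

/-- `U` lies in its own constraint set. [cite: Balaban1985Variational, (150) p.301] -/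
theorem self_mem_constraintSet {P : Params} (D : Domains P) (U : GaugeField P 0 (Matrix.specialUnitaryGroup (Fin 2) ℂ)) :
    U ∈ constraintSet D U := fun _ => rfl

/-- **PILLAR P0 `Localise150`, SUBSET FORM** (see the module docstring for every symbol): (i) k-uniform multi-level plaquette smallness of the iterated
(0.4)-averages of an R2-critical `U ∈ 𝔘_k(ε₀) ∩ 𝔅_k(V)`, `0 < ε₀ ≤ a`, with constant `C`; (ii) for every nested family `D` with `D.k = K − n`, `U` minimises the
Wilson action over print's regular fibre (6)(e) cut down by the multi-level constraints of `D`, for some `e > 0` at which `U ∈ (6)(e)`.  A predicate; nothing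
asserted. [cite: Balaban1985Variational, (146) and (150) p.301] -/
def Localise150At (L : ℕ) (C a : ℝ) : Prop :=
  ∀ (F : T3Family), F.L = L → ∀ (n K : ℕ) (hnK : n < K) (ε₀ : ℝ), 0 < ε₀ → ε₀ ≤ a →
    ∀ (V : GaugeField (F.P n) 0 (Matrix.specialUnitaryGroup (Fin 2) ℂ)) (U : GaugeField (F.P K) 0 (Matrix.specialUnitaryGroup (Fin 2) ℂ)),
      RegPr F n K ε₀ U → U ∈ fibre F ℰp n K hnK.le V → IsCritR2 F n K hnK.le V U →
        (∀ i, i ≤ K - n → PlaqSmall (C * ((F.L : ℝ) ^ (2 * i) * regThreshold F n K ε₀))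
          (Averaging.iter (fun j => blockAvg (P := F.P K) (j := j) (expMeanLogSU (n := Fin 2))) i U)) ∧
        ∀ (D : Domains (F.P K)), D.k = K - n →
          ∃ e : ℝ, 0 < e ∧ U ∈ regFibrePr F n K hnK.le e V ∧
            IsMinOn (fun W : GaugeField (F.P K) 0 (Matrix.specialUnitaryGroup (Fin 2) ℂ) => wilsonAction4 W)
              (regFibrePr F n K hnK.le e V ∩ constraintSet D U) U

/-- **CONJUNCT (ii) IS FREE** (every `L`): an R2-critical `U` minimises over (6)(e), hence over its intersection with any set containing `U` — print's
«because this space is defined by more restrictive conditions» (p.301). [cite: Balaban1985Variational, (150) p.301] -/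
theorem localCriticality_of_isCritR2 (F : T3Family) {n K : ℕ} (hnK : n < K)
    {V : GaugeField (F.P n) 0 (Matrix.specialUnitaryGroup (Fin 2) ℂ)} {U : GaugeField (F.P K) 0 (Matrix.specialUnitaryGroup (Fin 2) ℂ)}
    (hcrit : IsCritR2 F n K hnK.le V U) (D : Domains (F.P K)) :
    ∃ e : ℝ, 0 < e ∧ U ∈ regFibrePr F n K hnK.le e V ∧
      IsMinOn (fun W : GaugeField (F.P K) 0 (Matrix.specialUnitaryGroup (Fin 2) ℂ) => wilsonAction4 W)
        (regFibrePr F n K hnK.le e V ∩ constraintSet D U) U := by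
  obtain ⟨e, he, hUe, hmin⟩ := hcrit
  exact ⟨e, he, hUe, hmin.on_subset Set.inter_subset_left⟩

/-- **THE `L ≥ 7` HALF OF PILLAR P0, PROVED**: `Localise150At L 505 (2·10⁸·L³)⁻¹` for every block size `L ≥ 7` — conjunct (i) by the k-uniform multi-level
plaquette smallness `IterPlaqSmall.plaqSmall_iter_T3` (this lineage, p532781), conjunct (ii) by `localCriticality_of_isCritR2`.
[cite: Balaban1985Variational, (146) and (150) p.301] -/
theorem localise150At_of_ge7 (L : ℕ) (hL : 7 ≤ L) : Localise150At L 505 (2 * 10 ^ 8 * (L : ℝ) ^ 3)⁻¹ := by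
  intro F hF n K hnK ε₀ hε₀ hε₀a V U hreg _ hcrit
  have hFL : 7 ≤ F.L := by rw [hF]; exact hL
  have hL7 : (7 : ℝ) ≤ (F.L : ℝ) := by exact_mod_cast hFL
  have hL0 : (0 : ℝ) < F.L := by linarith
  refine ⟨fun i hik => ?_, fun D _ => localCriticality_of_isCritR2 F hnK hcrit D⟩
  -- `ε₀ ≤ (2·10⁸L³)⁻¹ ⇒ 50(500L + 7L²)ε₀ ≤ 1`
  have hε : 2 * 10 ^ 8 * (F.L : ℝ) ^ 3 * ε₀ ≤ 1 := by
    rw [hF] at hL0 ⊢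
    have hpos : (0 : ℝ) < 2 * 10 ^ 8 * (L : ℝ) ^ 3 := by positivity
    calc 2 * 10 ^ 8 * (L : ℝ) ^ 3 * ε₀ ≤ 2 * 10 ^ 8 * (L : ℝ) ^ 3 * (2 * 10 ^ 8 * (L : ℝ) ^ 3)⁻¹ :=
          mul_le_mul_of_nonneg_left hε₀a hpos.le
      _ = 1 := mul_inv_cancel₀ hpos.ne'
  have hε' : 50 * (500 * (F.L : ℝ) + 7 * (F.L : ℝ) ^ 2) * ε₀ ≤ 1 := by
    refine le_trans ?_ hε
    have hL1 : (1 : ℝ) ≤ F.L := by linarith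
    have h1 : (F.L : ℝ) ≤ (F.L : ℝ) ^ 3 := le_self_pow₀ hL1 (by norm_num)
    have h2 : (F.L : ℝ) ^ 2 ≤ (F.L : ℝ) ^ 3 := pow_le_pow_right₀ hL1 (by norm_num)
    nlinarith
  exact plaqSmall_iter_T3 F n K hFL hε₀ hε' U hreg.plaqSmall i hik

end Summit.QuantumFields.YangMills.Theorems.Prop8Localise

end
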